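import Summits.ValiantsHypothesis.ValiantsHypothesis.Theorems.KPlusLogSqLawTropicalGradedWalkPotD

/-!
# Route «KPlusLogSqLaw» — GRW-lite (all-`m` `K = 4` family), part P-T: the row potentials of the TOP states of the phases `w < m`

HONEST FRAMING.  Helper file of the chain `--supports` the crux `Summit.ValiantsHypothesis.ValiantsHypothesis.Theses.KPlusLogSqLaw.TropicalB`
(item `stmt-ValiantsHypothesis-19771`, route `KPlusLogSqLaw`; cell `pub-symmetroid`, seat val-sym-trop-p3 g14), on top of the
definitions file `…TropicalGradedWalkDefs.lean` and `…PotD.lean`.  It proves nothing about `TropicalB`, `WeakLifting`, `MatrixDescartes` or `VP ≠ VNP`: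
the GRW-lite family is a CENSUS-SIDE (lower bound) construction for `TropRootLawAt (n+1) 4`.

CONTENT.  The dual certificate for the dominance of the top state `(w, w, t)` (`0 ≤ t ≤ w < m`, slope `θ = L·w + M·w + 2t`, `thT`):
row potential `UT a = g·θ·a + muT (a − (m − w))`, the bend `muT` being the cumulative sum of the one-up steps `UB₃(j)` (block pairs
`j < t`, intended class `3`) and `UB₂(j)` (`j ≥ t`, intended class `2`), in closed form (`SUB3`, `STB`, `ST0` via `T2`, `T6`).
The slack lemmas (one per rival family) are in the companion files `…GradedWalkDomT*.lean`; located basis: exact integer checks of the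
certificate for every `m ≤ 16` (seat tools cert3.py).
-/

set_option linter.dupNamespace false
set_option autoImplicit false

namespace Summit.ValiantsHypothesis.ValiantsHypothesis.Theorems.LacunarySymmetroidMatrixDescartes.TropicalCensus

namespace GradedWalk

variable (n : ℕ)
/-! ### type-T potentials (top states `(w, w, t)`, `t ≤ w < m`) -/

/-- slope of the top state `(w, w, t)` of a phase `w < m`: `L·w + M·w + 2·t`. -/
def thT (w t : ℕ) : ℤ := LL n * w + MM n * w + 2 * t
/-- bend of the row potential over the block rows `1..jj`, `jj ≤ t − 1`: `Σ_{i ≤ jj} UB₃(i)`. -/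
def SUB3 (w t jj : ℕ) : ℤ :=
  ((((-2 : ℤ) * T2 ((jj + 1)) * mZ n * (w : ℤ) + ((-10 : ℤ) * T2 ((jj + 1)) * mZ n ^ 2 + (-2 : ℤ) * (jj : ℤ) * mZ n * (w : ℤ))) + ((4 : ℤ) * (jj : ℤ) * mZ n ^ 2 + ((-32 : ℤ) * T2 ((jj + 1)) * mZ n + (-6 : ℤ) * T2 ((jj + 1)) * (w : ℤ)))) + (((2 : ℤ) * T6 ((jj + 1)) * mZ n + ((12 : ℤ) * (jj : ℤ) * mZ n + (-2 : ℤ) * (jj : ℤ) * (t : ℤ))) + (((-6 : ℤ) * (jj : ℤ) * (w : ℤ) + (-6 : ℤ) * T2 ((jj + 1))) + ((5 : ℤ) * T6 ((jj + 1)) + -((jj : ℤ))))))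
/-- bend over the block rows `1..jj`, `jj ≥ t ≥ 1`: `Σ_{i < t} UB₃(i) + Σ_{t ≤ i ≤ jj} UB₂(i)`. -/
def STB (w t jj : ℕ) : ℤ :=
  (((((-2 : ℤ) * T2 ((jj + 1)) * mZ n * (w : ℤ) + (-10 : ℤ) * T2 ((jj + 1)) * mZ n ^ 2) + ((-2 : ℤ) * (jj : ℤ) * mZ n * (w : ℤ) + (4 : ℤ) * (jj : ℤ) * mZ n ^ 2)) + (((-32 : ℤ) * T2 ((jj + 1)) * mZ n + (-6 : ℤ) * T2 ((jj + 1)) * (w : ℤ)) + ((2 : ℤ) * T6 ((jj + 1)) * mZ n + (12 : ℤ) * (jj : ℤ) * mZ n))) + ((((-4 : ℤ) * (jj : ℤ) * (t : ℤ) + (-6 : ℤ) * (jj : ℤ) * (w : ℤ)) + ((2 : ℤ) * (t : ℤ) ^ 2 + (-4 : ℤ) * T2 ((jj + 1)))) + (((-2 : ℤ) * T2 (t) + (5 : ℤ) * T6 ((jj + 1))) + ((-3 : ℤ) * (t : ℤ) + (1 : ℤ)))))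
/-- bend for `t = 0` over the block rows `1..jj`: `Σ_{i ≤ jj} UB₂(i)`. -/
def ST0 (w jj : ℕ) : ℤ :=
  ((((-2 : ℤ) * T2 ((jj + 1)) * mZ n * (w : ℤ) + (-10 : ℤ) * T2 ((jj + 1)) * mZ n ^ 2) + ((-2 : ℤ) * (jj : ℤ) * mZ n * (w : ℤ) + ((4 : ℤ) * (jj : ℤ) * mZ n ^ 2 + (-32 : ℤ) * T2 ((jj + 1)) * mZ n))) + (((-6 : ℤ) * T2 ((jj + 1)) * (w : ℤ) + ((2 : ℤ) * T6 ((jj + 1)) * mZ n + (12 : ℤ) * (jj : ℤ) * mZ n)) + ((-6 : ℤ) * (jj : ℤ) * (w : ℤ) + ((-4 : ℤ) * T2 ((jj + 1)) + (5 : ℤ) * T6 ((jj + 1))))))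

/-- the bend of the row potential of the top state `(w, w, t)` at block row `j` (`j = 0`: no bend). -/
def muT (w t j : ℕ) : ℤ :=
  if t = 0 then ST0 n w j else if j < t then SUB3 n w t j else STB n w t j

/-- the row potential of the top state `(w, w, t)`: linear gauge plus the bend on the block rows `a ≥ m − w`. -/
def UT (w t a : ℕ) : ℤ := gG n * thT n w t * a + muT n w t (a - (n + 1 - w))

/-! ### small interface lemmas -/

/-- the slope of the top state `(w, w, t)`, `w < m`, is `thT`. -/
theorem theta_T {w : ℕ} (hw : w < n + 1) (t : ℕ) : theta n w w t = thT n w t := by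
  unfold theta thT Mw
  rw [if_neg (by omega), if_neg (lt_irrefl _)]

/-- no bend at or above the junction row. -/
theorem muT_zero (w t : ℕ) : muT n w t 0 = 0 := by
  unfold muT
  split_ifs with h1 h2
  · simp [ST0, T2, T6]
  · simp [SUB3, T2, T6]
  · exfalso; omega

/-- bend regime `t = 0`. -/
theorem muT_z (w j : ℕ) : muT n w 0 j = ST0 n w j := by
  unfold muT; rw [if_pos rfl]

/-- bend regime `j < t`. -/
theorem muT_lt {w t j : ℕ} (h : j < t) : muT n w t j = SUB3 n w t j := by
  unfold muT; rw [if_neg (by omega), if_pos h]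

/-- bend regime `j ≥ t ≥ 1`. -/
theorem muT_ge {w t j : ℕ} (ht : t ≠ 0) (h : ¬ j < t) : muT n w t j = STB n w t j := by
  unfold muT; rw [if_neg ht, if_neg h]

end GradedWalk

end Summit.ValiantsHypothesis.ValiantsHypothesis.Theorems.LacunarySymmetroidMatrixDescartes.TropicalCensus
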